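import Literature.NumberTheory.LFunctions.KowalskiMichelPeterssonFormula
import Literature.NumberTheory.Sieve.DivisorBound
import Literature.Analysis.FunctionSpaces.BesselJProofs
import Mathlib.Analysis.PSeries
import HarnessLib

/-!
# Kowalski–Michel (23) from Petersson's formula and Weil's bound: the repaired Petersson fact
# `kowalskiMichel2000_peterssonBound` is a THEOREM modulo the exact formula and Weil's bound

Source: E. Kowalski, P. Michel, *A lower bound for the rank of `J_0(q)`*, Acta Arith. 94 (2000),
§2.4.2, p. 312 [held: paper:doi-10-4064-aa-94-4-303-343, PDF p. 10, L36–62]: "The trivial bound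
for this [`J(l₁,l₂) = (2π/q) ∑_{r≥1} r⁻¹ S(l₁,l₂;qr) J₁(4π√(l₁l₂)/(qr))`], from Weil's bound for
Kloosterman sums and `J₁(x) ≪ x`, is (23) `J(l₁, l₂) ≪_ε (l₁l₂)^{1/2+ε} q^{−3/2}` … since
`(m, q) = 1`".

This file PROVES that printed deduction in the tree's vocabulary:

* `peterssonBound_of_peterssonFormula :
    kowalskiMichel2000_peterssonFormula → weil_kloosterman_bound → kowalskiMichel2000_peterssonBound`

i.e. the repaired fact of record (`KowalskiMichelPeterssonFormula.lean`, binder `¬ (q ∣ m ∧ q ∣ n)`)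
follows from Petersson's formula AS PRINTED (`kowalskiMichel2000_peterssonFormula`, same file) and
Weil's bound AS PRINTED (`weil_kloosterman_bound`, `KloostermanWeil.lean`), using two tree theorems:
the divisor bound `τ(n) ≤ C_δ n^δ` (`Literature.NumberTheory.Sieve.exists_card_divisors_le_mul_rpow'`,
Hardy–Wright Thm. 315) and `|J₁(x)| ≤ x/2` (`Literature.Analysis.FunctionSpaces.abs_besselJ_one_le_half_mul`,
DLMF 10.14.4). The side condition is used exactly once, as in print: for `q ∤ (m, n)` the gcd in
Weil's bound is `((m, n), qr) = ((m, n), r)`, so no power of the level `q` is lost; the remaining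
`r`-sum is bounded by `((m,n), r)^{1/2} ≤ (m,n)^{θ/2} r^{(1−θ)/2}` (`θ = min(ε, 1)`),
`τ(qr) ≤ 2τ(r) ≤ 2 C r^{θ/4}` and `∑_r r^{−1−θ/4} < ∞`, giving
`|∑ʰ λ_f(m)λ_f(n) − δ(m,n)| ≤ 8π² C ζ(1+θ/4) · (mn)^{1/2+ε} q^{−3/2}`.

No definition, no named fact (D-0026); nothing here uses the negative lemma
`not_kowalskiMichel2000_petersson`.

## References

* [KowalskiMichel2000] Acta Arith. 94 (2000), §2.4.2 p. 312, (23).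
* [Iwaniec2002] H. Iwaniec, *Spectral methods of automorphic forms*, (2.25) (Weil's bound).
* [HardyWright2008] Thm. 315 (the divisor bound).
* [DLMF] 10.14.4 (`|J₁(x)| ≤ |x|/2`).
-/

noncomputable section

open scoped Real
open Complex
open Literature.Analysis.FunctionSpaces (besselJ abs_besselJ_one_le_half_mul)

namespace Literature.NumberTheory.LFunctions.KowalskiMichel2000

/-! ### Two elementary inequalities -/

/-- For `q` prime and `r ≠ 0`: `τ(qr) ≤ 2 τ(r)` (every divisor of `qr` is `d` or `qd` with `d ∣ r`).
[cite: HardyWright2008, Theorem 315 (context: elementary divisor counting)] -/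
theorem card_divisors_prime_mul_le {q r : ℕ} (hq : q.Prime) (hr : r ≠ 0) :
    (q * r).divisors.card ≤ 2 * r.divisors.card := by
  classical
  have hsub : (q * r).divisors ⊆ r.divisors ∪ r.divisors.image (fun d ↦ q * d) := by
    intro d hd
    rw [Nat.mem_divisors] at hd
    obtain ⟨hdvd, -⟩ := hd
    by_cases hqd : q ∣ d
    · obtain ⟨e, rfl⟩ := hqd
      apply Finset.mem_union_right
      rw [Finset.mem_image]
      refine ⟨e, ?_, rfl⟩
      rw [Nat.mem_divisors]
      exact ⟨Nat.dvd_of_mul_dvd_mul_left hq.pos hdvd, hr⟩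
    · apply Finset.mem_union_left
      rw [Nat.mem_divisors]
      refine ⟨?_, hr⟩
      have hcop : Nat.Coprime d q := Nat.coprime_comm.mp ((hq.coprime_iff_not_dvd).mpr hqd)
      exact hcop.dvd_of_dvd_mul_left hdvd
  calc (q * r).divisors.card ≤ (r.divisors ∪ r.divisors.image (fun d ↦ q * d)).card :=
        Finset.card_le_card hsub
    _ ≤ r.divisors.card + (r.divisors.image (fun d ↦ q * d)).card := Finset.card_union_le _ _
    _ ≤ r.divisors.card + r.divisors.card := Nat.add_le_add_left Finset.card_image_le _
    _ = 2 * r.divisors.card := by ring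

/-- `min(a, b) ≤ a^θ b^{1−θ}` for `a, b ≥ 0`, `0 ≤ θ ≤ 1`. [folklore] -/
private theorem min_le_rpow_mul_rpow {a b θ : ℝ} (ha : 0 ≤ a) (hb : 0 ≤ b) (h0 : 0 ≤ θ)
    (h1 : θ ≤ 1) : min a b ≤ a ^ θ * b ^ (1 - θ) := by
  have hμ : 0 ≤ min a b := le_min ha hb
  have h1' : 0 ≤ 1 - θ := by linarith
  calc min a b = (min a b) ^ θ * (min a b) ^ (1 - θ) := by
        rw [← Real.rpow_add' hμ (by norm_num : θ + (1 - θ) ≠ 0)]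
        norm_num
    _ ≤ a ^ θ * b ^ (1 - θ) := by
        gcongr
        · exact min_le_left a b
        · exact min_le_right a b

/-! ### The termwise bound from Weil's bound and `|J₁(x)| ≤ x/2` -/

/-- **One term of `J(m, n)`** (Kowalski–Michel p. 312): for `q` prime, `q ∤ (m, n)`, `r ≥ 1`,
`0 < θ ≤ 1` and a divisor-bound constant `τ(r) ≤ C r^{θ/4}`:
`|r⁻¹ S(m,n;qr) J₁(4π√(mn)/(qr))| ≤ 4π C √(mn) q^{−1/2} (m,n)^{θ/2} · r^{−1−θ/4}`
(Weil: `|S| ≤ ((m,n),qr)^{1/2}(qr)^{1/2}τ(qr)`, `((m,n),qr) = ((m,n),r) ≤ (m,n)^θ r^{1−θ}`,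
`τ(qr) ≤ 2τ(r)`, `|J₁(x)| ≤ x/2`). [cite: KowalskiMichel2000, §2.4.2 p. 312 (23) (proof: "from Weil's bound … and J₁(x) ≪ x")] -/
theorem norm_petKloostermanTerm_le (hW : weil_kloosterman_bound) {q : ℕ} [NeZero q]
    (hq : q.Prime) {m n : ℕ} (hm : 1 ≤ m) (hmn : ¬ (q ∣ m ∧ q ∣ n)) {θ : ℝ}
    (hθ0 : 0 < θ) (hθ1 : θ ≤ 1) {C : ℝ} (hC : ∀ r : ℕ, ((r.divisors.card : ℕ) : ℝ) ≤ C * (r : ℝ) ^ (θ / 4))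
    (r : ℕ) :
    ‖petKloostermanTerm q m n r‖ ≤
      4 * π * C * Real.sqrt ((m : ℝ) * n) * (q : ℝ) ^ (-(1 / 2 : ℝ)) *
        ((m.gcd n : ℕ) : ℝ) ^ (θ / 2) * (r : ℝ) ^ (-(1 + θ / 4)) := by
  rcases eq_or_ne r 0 with rfl | hr
  · have h0 : ((0 : ℕ) : ℝ) ^ (-(1 + θ / 4)) = 0 := by
      rw [Nat.cast_zero]
      exact Real.zero_rpow (by linarith)
    rw [petKloostermanTerm_zero, norm_zero, h0, mul_zero]
  haveI : NeZero (q * r) := ⟨mul_ne_zero hq.ne_zero hr⟩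
  have hq0 : (0 : ℝ) < q := by exact_mod_cast hq.pos
  have hr0 : (0 : ℝ) < r := by exact_mod_cast Nat.pos_of_ne_zero hr
  have hqr0 : (0 : ℝ) < (q : ℝ) * r := mul_pos hq0 hr0
  have hC0 : 0 ≤ C := by
    have h := hC 1
    simp at h
    linarith
  set g : ℕ := m.gcd n with hgdef
  have hgpos : 0 < g := Nat.gcd_pos_of_pos_left n (by omega)
  have hg0 : (0 : ℝ) < g := by exact_mod_cast hgpos
  -- Weil's bound at modulus `qr`, with the gcd reduced by the side condition
  have hcop : Nat.Coprime q g :=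
    (hq.coprime_iff_not_dvd).mpr (fun h ↦ hmn (Nat.dvd_gcd_iff.mp h))
  have hgcd : Nat.gcd (Nat.gcd m n) (q * r) = Nat.gcd g r := by
    rw [← hgdef]
    exact hcop.gcd_mul_left_cancel_right r
  have hWeil : ‖kloostermanSum (q * r) (m : ZMod (q * r)) (n : ZMod (q * r))‖ ≤
      Real.sqrt (Nat.gcd g r : ℕ) * Real.sqrt ((q : ℝ) * r) * (((q * r).divisors.card : ℕ) : ℝ) := by
    have h := hW (q * r) (m : ℤ) (n : ℤ)
    simp only [Int.cast_natCast, Int.natAbs_natCast, hgcd, Nat.cast_mul] at h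
    exact h
  -- the three elementary estimates
  have hτ : (((q * r).divisors.card : ℕ) : ℝ) ≤ 2 * C * (r : ℝ) ^ (θ / 4) := by
    calc (((q * r).divisors.card : ℕ) : ℝ) ≤ ((2 * r.divisors.card : ℕ) : ℝ) := by
          exact_mod_cast card_divisors_prime_mul_le hq hr
      _ = 2 * ((r.divisors.card : ℕ) : ℝ) := by push_cast; ring
      _ ≤ 2 * (C * (r : ℝ) ^ (θ / 4)) := by
          gcongr
          exact hC r
      _ = 2 * C * (r : ℝ) ^ (θ / 4) := by ring
  have hsqrt : Real.sqrt (Nat.gcd g r : ℕ) ≤ (g : ℝ) ^ (θ / 2) * (r : ℝ) ^ ((1 - θ) / 2) := by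
    have h1 : ((Nat.gcd g r : ℕ) : ℝ) ≤ min (g : ℝ) r := by
      rw [le_min_iff]
      constructor
      · exact_mod_cast Nat.gcd_le_left r hgpos
      · exact_mod_cast Nat.le_of_dvd (Nat.pos_of_ne_zero hr) (Nat.gcd_dvd_right g r)
    have h2 : ((Nat.gcd g r : ℕ) : ℝ) ≤ (g : ℝ) ^ θ * (r : ℝ) ^ (1 - θ) :=
      h1.trans (min_le_rpow_mul_rpow hg0.le hr0.le hθ0.le hθ1)
    rw [Real.sqrt_eq_rpow]
    calc ((Nat.gcd g r : ℕ) : ℝ) ^ (1 / 2 : ℝ) ≤ ((g : ℝ) ^ θ * (r : ℝ) ^ (1 - θ)) ^ (1 / 2 : ℝ) :=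
          Real.rpow_le_rpow (by positivity) h2 (by norm_num)
      _ = (g : ℝ) ^ (θ / 2) * (r : ℝ) ^ ((1 - θ) / 2) := by
          rw [Real.mul_rpow (by positivity) (by positivity), ← Real.rpow_mul hg0.le,
            ← Real.rpow_mul hr0.le]
          ring_nf
  have hx0 : 0 ≤ 4 * π * Real.sqrt ((m : ℝ) * n) / ((q : ℝ) * r) := by positivity
  have hJ : |besselJ 1 (4 * π * Real.sqrt ((m : ℝ) * n) / ((q : ℝ) * r))| ≤
      (4 * π * Real.sqrt ((m : ℝ) * n) / ((q : ℝ) * r)) / 2 := abs_besselJ_one_le_half_mul hx0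
  -- assemble
  rw [petKloostermanTerm_of_ne_zero q m n hr]
  rw [norm_mul, norm_mul, norm_inv, Complex.norm_natCast, Complex.norm_real, Real.norm_eq_abs]
  have hS0 : 0 ≤ ‖kloostermanSum (q * r) (m : ZMod (q * r)) (n : ZMod (q * r))‖ := norm_nonneg _
  calc (r : ℝ)⁻¹ * ‖kloostermanSum (q * r) (m : ZMod (q * r)) (n : ZMod (q * r))‖ *
        |besselJ 1 (4 * π * Real.sqrt ((m : ℝ) * n) / ((q : ℝ) * r))|
      ≤ (r : ℝ)⁻¹ * (((g : ℝ) ^ (θ / 2) * (r : ℝ) ^ ((1 - θ) / 2)) * Real.sqrt ((q : ℝ) * r) *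
          (2 * C * (r : ℝ) ^ (θ / 4))) * ((4 * π * Real.sqrt ((m : ℝ) * n) / ((q : ℝ) * r)) / 2) := by
        gcongr
        calc ‖kloostermanSum (q * r) (m : ZMod (q * r)) (n : ZMod (q * r))‖
            ≤ Real.sqrt (Nat.gcd g r : ℕ) * Real.sqrt ((q : ℝ) * r) * (((q * r).divisors.card : ℕ) : ℝ) :=
              hWeil
          _ ≤ ((g : ℝ) ^ (θ / 2) * (r : ℝ) ^ ((1 - θ) / 2)) * Real.sqrt ((q : ℝ) * r) *
              (2 * C * (r : ℝ) ^ (θ / 4)) := by gcongr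
    _ = 4 * π * C * Real.sqrt ((m : ℝ) * n) * (q : ℝ) ^ (-(1 / 2 : ℝ)) * (g : ℝ) ^ (θ / 2) *
          (r : ℝ) ^ (-(1 + θ / 4)) := by
        rw [Real.sqrt_eq_rpow ((q : ℝ) * r), Real.mul_rpow hq0.le hr0.le]
        have er : (r : ℝ)⁻¹ * (r : ℝ) ^ ((1 - θ) / 2) * (r : ℝ) ^ (1 / 2 : ℝ) * (r : ℝ) ^ (θ / 4) /
            (r : ℝ) = (r : ℝ) ^ (-(1 + θ / 4)) := by
          rw [← Real.rpow_neg_one, div_eq_mul_inv, ← Real.rpow_neg_one, ← Real.rpow_add hr0,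
            ← Real.rpow_add hr0, ← Real.rpow_add hr0, ← Real.rpow_add hr0]
          congr 1
          ring
        have eq' : (q : ℝ) ^ (1 / 2 : ℝ) / (q : ℝ) = (q : ℝ) ^ (-(1 / 2 : ℝ)) := by
          rw [div_eq_mul_inv, ← Real.rpow_neg_one, ← Real.rpow_add hq0]
          congr 1
          ring
        calc (r : ℝ)⁻¹ * (((g : ℝ) ^ (θ / 2) * (r : ℝ) ^ ((1 - θ) / 2)) *
              ((q : ℝ) ^ (1 / 2 : ℝ) * (r : ℝ) ^ (1 / 2 : ℝ)) * (2 * C * (r : ℝ) ^ (θ / 4))) *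
              ((4 * π * Real.sqrt ((m : ℝ) * n) / ((q : ℝ) * r)) / 2)
            = 4 * π * C * Real.sqrt ((m : ℝ) * n) * ((q : ℝ) ^ (1 / 2 : ℝ) / (q : ℝ)) *
                (g : ℝ) ^ (θ / 2) *
                ((r : ℝ)⁻¹ * (r : ℝ) ^ ((1 - θ) / 2) * (r : ℝ) ^ (1 / 2 : ℝ) * (r : ℝ) ^ (θ / 4) /
                  (r : ℝ)) := by
              field_simp
          _ = _ := by rw [er, eq']

/-! ### The printed deduction (23): the repaired fact from Petersson's formula and Weil's bound -/

/-- **Kowalski–Michel 2000, (23), as a theorem of the tree:** Petersson's formula with its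
Kloosterman–Bessel term (`kowalskiMichel2000_peterssonFormula`) and Weil's bound
(`weil_kloosterman_bound`) imply the repaired Petersson estimate `kowalskiMichel2000_peterssonBound`:
for every `ε > 0` there is `C` with `|∑ʰ_{f∈S_2(q)^*} λ_f(m)λ_f(n) − δ(m,n)| ≤ C (mn)^{1/2+ε} q^{−3/2}`
for all primes `q` and all `m, n ≥ 1` with `q ∤ (m, n)`. One may take
`C = 8π² C_{θ/4} ∑_{r≥1} r^{−1−θ/4}`, `θ = min(ε, 1)`, `C_δ` the divisor-bound constant.
[cite: KowalskiMichel2000, §2.4.2 p. 312 (23)] -/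
theorem peterssonBound_of_peterssonFormula (hF : kowalskiMichel2000_peterssonFormula)
    (hW : weil_kloosterman_bound) : kowalskiMichel2000_peterssonBound := by
  intro ε hε
  set θ : ℝ := min ε 1 with hθdef
  have hθ0 : 0 < θ := lt_min hε one_pos
  have hθ1 : θ ≤ 1 := min_le_right _ _
  have hθε : θ ≤ ε := min_le_left _ _
  obtain ⟨Cδ, hCδ1, hCδ⟩ :=
    Literature.NumberTheory.Sieve.exists_card_divisors_le_mul_rpow' (by positivity : 0 < θ / 4)
  have hZsum : Summable (fun r : ℕ ↦ (r : ℝ) ^ (-(1 + θ / 4))) :=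
    Real.summable_nat_rpow.mpr (by linarith)
  set Z : ℝ := ∑' r : ℕ, (r : ℝ) ^ (-(1 + θ / 4)) with hZdef
  have hZ0 : 0 ≤ Z := tsum_nonneg fun r ↦ Real.rpow_nonneg (Nat.cast_nonneg r) _
  have hCδ0 : 0 ≤ Cδ := by linarith
  refine ⟨2 * π * (4 * π * Cδ) * Z, fun q _ hq m n hm hn hmn ↦ ?_⟩
  obtain ⟨hS, hpet⟩ := hF q hq m n hm hn
  have hq0 : (0 : ℝ) < q := by exact_mod_cast hq.pos
  have hm0 : (0 : ℝ) < m := by exact_mod_cast hm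
  have hn0 : (0 : ℝ) < n := by exact_mod_cast hn
  have hmn1 : (1 : ℝ) ≤ (m : ℝ) * n := by
    have h1 : (1 : ℝ) ≤ m := by exact_mod_cast hm
    have h2 : (1 : ℝ) ≤ n := by exact_mod_cast hn
    nlinarith
  set g : ℕ := m.gcd n with hgdef
  -- termwise majorant `B r := A · r^{−1−θ/4}`
  set A : ℝ := 4 * π * Cδ * Real.sqrt ((m : ℝ) * n) * (q : ℝ) ^ (-(1 / 2 : ℝ)) *
    ((g : ℕ) : ℝ) ^ (θ / 2) with hAdef
  have hA0 : 0 ≤ A := by positivity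
  have hterm : ∀ r : ℕ, ‖petKloostermanTerm q m n r‖ ≤ A * (r : ℝ) ^ (-(1 + θ / 4)) :=
    fun r ↦ norm_petKloostermanTerm_le hW hq hm hmn hθ0 hθ1 (fun r ↦ hCδ r) r
  have hBsum : Summable (fun r : ℕ ↦ A * (r : ℝ) ^ (-(1 + θ / 4))) := hZsum.mul_left A
  -- `‖pet − δ‖ = ‖J‖ ≤ (2π/q) ∑ ‖term‖ ≤ (2π/q) A Z`
  rw [hpet, sub_sub_cancel_left, norm_neg, petJ_def, norm_mul]
  have h2pi : ‖(2 * π / q : ℂ)‖ = 2 * π / q := by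
    rw [show (2 * π / q : ℂ) = ((2 * π / q : ℝ) : ℂ) by push_cast; rfl, Complex.norm_real,
      Real.norm_eq_abs, abs_of_nonneg (by positivity)]
  rw [h2pi]
  have hsum_le : ‖∑' r : ℕ, petKloostermanTerm q m n r‖ ≤ A * Z := by
    calc ‖∑' r : ℕ, petKloostermanTerm q m n r‖ ≤ ∑' r : ℕ, ‖petKloostermanTerm q m n r‖ :=
          norm_tsum_le_tsum_norm hS
      _ ≤ ∑' r : ℕ, A * (r : ℝ) ^ (-(1 + θ / 4)) := hS.tsum_le_tsum hterm hBsum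
      _ = A * Z := by rw [tsum_mul_left]
  -- the remaining bookkeeping: `√(mn) (m,n)^{θ/2} ≤ (mn)^{1/2+ε}` and `q^{−1/2}/q = q^{−3/2}`
  have hg_le : ((g : ℕ) : ℝ) ^ (θ / 2) ≤ ((m : ℝ) * n) ^ (θ / 4) := by
    have hgm : (g : ℝ) ≤ m := by exact_mod_cast Nat.gcd_le_left n (by omega)
    have hgn : (g : ℝ) ≤ n := by exact_mod_cast Nat.le_of_dvd (by omega) (Nat.gcd_dvd_right m n)
    have hg0 : (0 : ℝ) ≤ g := Nat.cast_nonneg _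
    have hsq : ((g : ℝ)) ^ (2 : ℝ) ≤ (m : ℝ) * n := by
      rw [show (2 : ℝ) = ((2 : ℕ) : ℝ) by norm_num, Real.rpow_natCast, sq]
      exact mul_le_mul hgm hgn hg0 hm0.le
    calc ((g : ℕ) : ℝ) ^ (θ / 2) = (((g : ℝ)) ^ (2 : ℝ)) ^ (θ / 4) := by
          rw [← Real.rpow_mul hg0]; ring_nf
      _ ≤ ((m : ℝ) * n) ^ (θ / 4) := Real.rpow_le_rpow (by positivity) hsq (by positivity)
  have hmain : Real.sqrt ((m : ℝ) * n) * ((g : ℕ) : ℝ) ^ (θ / 2) ≤ ((m : ℝ) * n) ^ (1 / 2 + ε) := by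
    calc Real.sqrt ((m : ℝ) * n) * ((g : ℕ) : ℝ) ^ (θ / 2)
        ≤ ((m : ℝ) * n) ^ (1 / 2 : ℝ) * ((m : ℝ) * n) ^ (θ / 4) := by
          rw [Real.sqrt_eq_rpow]
          gcongr
      _ = ((m : ℝ) * n) ^ (1 / 2 + θ / 4) := by rw [← Real.rpow_add (by positivity)]
      _ ≤ ((m : ℝ) * n) ^ (1 / 2 + ε) := Real.rpow_le_rpow_of_exponent_le hmn1 (by linarith)
  have hq32 : (q : ℝ) ^ (-(1 / 2 : ℝ)) / q = (q : ℝ) ^ (-(3 / 2 : ℝ)) := by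
    rw [div_eq_mul_inv, ← Real.rpow_neg_one, ← Real.rpow_add hq0]
    norm_num
  calc 2 * π / q * ‖∑' r : ℕ, petKloostermanTerm q m n r‖ ≤ 2 * π / q * (A * Z) := by
        gcongr
    _ = 2 * π * (4 * π * Cδ) * Z * (Real.sqrt ((m : ℝ) * n) * ((g : ℕ) : ℝ) ^ (θ / 2)) *
          ((q : ℝ) ^ (-(1 / 2 : ℝ)) / q) := by
        rw [hAdef]
        field_simp
    _ ≤ 2 * π * (4 * π * Cδ) * Z * ((m : ℝ) * n) ^ (1 / 2 + ε) * ((q : ℝ) ^ (-(1 / 2 : ℝ)) / q) := by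
        gcongr
    _ = 2 * π * (4 * π * Cδ) * Z * ((m : ℝ) * n) ^ (1 / 2 + ε) * (q : ℝ) ^ (-(3 / 2 : ℝ)) := by
        rw [hq32]

end Literature.NumberTheory.LFunctions.KowalskiMichel2000

end
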